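import Literature.NumberTheory.GaloisRepresentations.SemiLocalArchimedeanShapiro
import Mathlib.RepresentationTheory.Homological.GroupCohomology.Hilbert90
import Mathlib.FieldTheory.Fixed
import HarnessLib

/-!
# Hilbert 90 at the archimedean places: `H¹(Stab(w₀), E_{w₀}ˣ) = 0` and `H¹(Gal(E/F), ∏_{w ∣ v} E_wˣ) = 0`
# for EVERY infinite place (Harari Cor. 13.2; Tate, C–F VII §7.3)

Topic `NumberTheory/GaloisRepresentations`; namespace `Literature.NumberTheory.GaloisRepresentations.ArchHerbrand`,
continuing `SemiLocalArchimedeanShapiro.lean` (which has the decomposition group `Stab(w₀)` acting on `E_{w₀}ˣ`,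
`archLocalUnitsRep w₀`, Shapiro `Hⁿ(Gal(E/F), ∏_{w∣v} E_wˣ) ≅ Hⁿ(Stab(w₀), E_{w₀}ˣ)` = `groupCohomologyArchUnitsRepIso`,
and the vanishing for `n ≥ 1` at an UNRAMIFIED infinite place only).  Definitions with bodies and theorems; NO
named fact, no `sorry`, no instance (the ring action of `Stab(w₀)` on `E_{w₀}` is a `def` used with `letI`), no
notation; fields in `Type`.

Mathematics.  At a ramified (real-under-complex) infinite place the decomposition group `Stab(w₀) = {1, c}`
acts on `E_{w₀} ≅ ℂ` through complex conjugation, and `H¹({1,c}, ℂˣ) = 0` is Hilbert's Theorem 90 for `ℂ/ℝ`.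
Uniformly for all infinite places: `Stab(w₀)` acts FAITHFULLY on the field `L = E_{w₀}` by ring automorphisms
(the continuous extensions `g_{w₀}` of `g ∈ Stab(w₀)`; faithful because `E ⊆ E_{w₀}`), hence (Artin, Mathlib
`FixedPoints.toAlgAutMulEquiv`) `Stab(w₀) ≃* Aut_K(L)` for `K = L^{Stab(w₀)}` with `L/K` finite, and Noether's
form of Hilbert 90 (Mathlib `groupCohomology.H1ofAutOnUnitsUnique`) gives `H¹(Aut_K(L), Lˣ) = 0`; transport
along the group isomorphism (`groupCohomology.mapIso`).  This is the archimedean half of Harari's Cor. 13.2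
"`H¹(G, I_K) = 0`" (with `isZero_H1_unitsRep` of `SemiLocalShapiro.lean` for the finite places).

## What is formalised (`F E : Type` fields, `w₀ : InfinitePlace E`)

* `stabilizerRingAction w₀ : MulSemiringAction Stab(w₀) E_{w₀}` (a `def`), `stabilizerRingAction_smul`,
  `faithfulSMul_stabilizer` (faithfulness);
* **`isZero_H1_archLocalUnitsRep w₀ : H¹(Stab(w₀), E_{w₀}ˣ) = 0`** (`[Finite (E ≃ₐ[F] E)]`);
* **`isZero_H1_archUnitsRep v : H¹(Gal(E/F), ∏_{w ∣ v} E_wˣ) = 0`** for every infinite place `v` of `F`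
  (`E/F` finite Galois; Shapiro + the above).

## References
* D. Harari, *Galois Cohomology and Class Field Theory*, Springer (2020), §13.1 Cor. 13.2 (and proof of
  Prop. 13.1 (b), archimedean places). [Harari2020]
* J. W. S. Cassels, A. Fröhlich (eds.), *Algebraic Number Theory* (1967), Ch. VII (Tate) §7.3 (consequence
  "`H¹(G, J_L) = 0`"). [CasselsFrohlichANT1967]
* J.-P. Serre, *Local Fields*, GTM 67 (1979), Ch. X §1 Prop. 2 (Hilbert 90). [SerreLocalFields1979]
-/

noncomputable section

open NumberField NumberField.InfinitePlace CategoryTheory CategoryTheory.Limits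
open Literature.NumberTheory.Automorphic

namespace Literature.NumberTheory.GaloisRepresentations

namespace ArchHerbrand

variable {F : Type} [Field F] {E : Type} [Field E] [Algebra F E]

/-! ## §1. `Stab(w₀)` acts faithfully on the field `E_{w₀}` by ring automorphisms -/

/-- **The decomposition group `Stab(w₀)` acts on `E_{w₀}` by ring automorphisms** `g ↦ g_{w₀}` (the
continuous extension `galInfiniteCompletionMap g` at `g w₀ = w₀`): a `MulSemiringAction` structure, kept as a
`def` (used locally with `letI`), whose unit action is `archLocalUnitsRepr w₀`.
[cite: CasselsFrohlichANT1967, Ch. VII §1.1] -/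
@[reducible] def stabilizerRingAction (w₀ : InfinitePlace E) :
    MulSemiringAction (MulAction.stabilizer (E ≃ₐ[F] E) w₀) w₀.Completion where
  smul g y := galInfiniteCompletionMap (g : E ≃ₐ[F] E) (coe_stabilizer_smul w₀ g) y
  one_smul y := (galInfiniteCompletionMap_congr_left F (OneMemClass.coe_one _) _ (one_smul _ _) y).trans
    (galInfiniteCompletionMap_one F _ y)
  mul_smul g g' y := by
    change galInfiniteCompletionMap ((g * g' : MulAction.stabilizer (E ≃ₐ[F] E) w₀) : E ≃ₐ[F] E) _ y =
      galInfiniteCompletionMap (g : E ≃ₐ[F] E) (coe_stabilizer_smul w₀ g)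
        (galInfiniteCompletionMap (g' : E ≃ₐ[F] E) (coe_stabilizer_smul w₀ g') y)
    rw [galInfiniteCompletionMap_galInfiniteCompletionMap]
    exact galInfiniteCompletionMap_congr_left F (Subgroup.coe_mul _ g g') _ _ y
  smul_zero g := map_zero (galInfiniteCompletionMap (g : E ≃ₐ[F] E) (coe_stabilizer_smul w₀ g))
  smul_add g x y := map_add (galInfiniteCompletionMap (g : E ≃ₐ[F] E) (coe_stabilizer_smul w₀ g)) x y
  smul_one g := map_one (galInfiniteCompletionMap (g : E ≃ₐ[F] E) (coe_stabilizer_smul w₀ g))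
  smul_mul g x y := map_mul (galInfiniteCompletionMap (g : E ≃ₐ[F] E) (coe_stabilizer_smul w₀ g)) x y

/-- Unfolding: under `stabilizerRingAction`, `g • y = g_{w₀}(y)`. [cite: CasselsFrohlichANT1967, Ch. VII §1.1] -/
theorem stabilizerRingAction_smul (w₀ : InfinitePlace E) (g : MulAction.stabilizer (E ≃ₐ[F] E) w₀)
    (y : w₀.Completion) :
    (letI := stabilizerRingAction (F := F) w₀; g • y) =
      galInfiniteCompletionMap (g : E ≃ₐ[F] E) (coe_stabilizer_smul w₀ g) y := rfl

/-- **The action of `Stab(w₀)` on `E_{w₀}` is faithful**: an element acting trivially on `E_{w₀}` acts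
trivially on the subfield `E` (`g_{w₀}` extends `g`, and `E → E_{w₀} → ℂ` is the injective embedding of `w₀`).
[cite: CasselsFrohlichANT1967, Ch. VII §1.1] -/
theorem faithfulSMul_stabilizer (w₀ : InfinitePlace E) :
    letI := stabilizerRingAction (F := F) w₀
    FaithfulSMul (MulAction.stabilizer (E ≃ₐ[F] E) w₀) w₀.Completion := by
  letI := stabilizerRingAction (F := F) w₀
  refine ⟨fun {g g'} h => Subtype.ext (AlgEquiv.ext fun x => ?_)⟩
  have hx := h (x : w₀.Completion)
  rw [stabilizerRingAction_smul, stabilizerRingAction_smul, galInfiniteCompletionMap_coe,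
    galInfiniteCompletionMap_coe] at hx
  have := congrArg (Completion.extensionEmbedding w₀) hx
  rw [extensionEmbedding_coe', extensionEmbedding_coe'] at this
  exact w₀.embedding.injective this

/-! ## §2. Hilbert 90 for the decomposition group at an infinite place -/

/-- **`H¹(Stab(w₀), E_{w₀}ˣ) = 0` at every infinite place `w₀`** (ramified or not): `Stab(w₀)` is the full
automorphism group of `E_{w₀}` over its fixed field (Artin; Mathlib `FixedPoints.toAlgAutMulEquiv`), and
`H¹(Aut_K(L), Lˣ) = 0` (Noether–Hilbert 90, Mathlib `groupCohomology.H1ofAutOnUnitsUnique`), transported by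
`groupCohomology.mapIso`. [cite: Harari2020, §13.1 Cor. 13.2][cite: SerreLocalFields1979, Ch. X §1 Prop. 2] -/
theorem isZero_H1_archLocalUnitsRep [Finite (E ≃ₐ[F] E)] (w₀ : InfinitePlace E) :
    IsZero (groupCohomology (archLocalUnitsRep (F := F) w₀) 1) := by
  letI := stabilizerRingAction (F := F) w₀
  haveI := faithfulSMul_stabilizer (F := F) w₀
  let K := FixedPoints.subfield (MulAction.stabilizer (E ≃ₐ[F] E) w₀) w₀.Completion
  let e : MulAction.stabilizer (E ≃ₐ[F] E) w₀ ≃* (w₀.Completion ≃ₐ[K] w₀.Completion) :=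
    FixedPoints.toAlgAutMulEquiv (MulAction.stabilizer (E ≃ₐ[F] E) w₀) w₀.Completion
  have iso : groupCohomology (archLocalUnitsRep (F := F) w₀) 1 ≅
      groupCohomology (Rep.ofAlgebraAutOnUnits K w₀.Completion) 1 :=
    groupCohomology.mapIso e (LinearEquiv.refl ℤ _) (fun g => LinearMap.ext fun x => by
      apply Additive.toMul.injective
      refine Units.ext ?_
      change galInfiniteCompletionMap (g : E ≃ₐ[F] E) (coe_stabilizer_smul w₀ g)
          ((Additive.toMul x : (w₀.Completion)ˣ) : w₀.Completion) =
        (((e g) • (Additive.toMul x : (w₀.Completion)ˣ) : (w₀.Completion)ˣ) : w₀.Completion)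
      rw [AlgEquiv.smul_units_def, Units.coe_map]
      rfl) 1
  haveI : Subsingleton (groupCohomology (Rep.ofAlgebraAutOnUnits K w₀.Completion) 1) :=
    inferInstanceAs (Subsingleton (groupCohomology.H1 (Rep.ofAlgebraAutOnUnits K w₀.Completion)))
  exact (ModuleCat.isZero_of_subsingleton _).of_iso iso

/-- **`H¹(Gal(E/F), ∏_{w ∣ v} E_wˣ) = 0` for EVERY infinite place `v` of `F`**, `E/F` finite Galois (Shapiro
`groupCohomologyArchUnitsRepIso` + `isZero_H1_archLocalUnitsRep`): the archimedean half of Harari's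
"`H¹(G, I_K) = 0`" / Tate's "`H¹(G, J_L) = 0`". [cite: Harari2020, §13.1 Cor. 13.2][cite: CasselsFrohlichANT1967, Ch. VII §7.3] -/
theorem isZero_H1_archUnitsRep [FiniteDimensional F E] [IsGalois F E] (v : InfinitePlace F) :
    IsZero (groupCohomology (archUnitsRep (E := E) v) 1) := by
  obtain ⟨w₀, rfl⟩ := comap_surjective (K := E) (k := F) v
  exact (isZero_H1_archLocalUnitsRep (F := F) w₀).of_iso (groupCohomologyArchUnitsRepIso w₀ 1)

end ArchHerbrand

end Literature.NumberTheory.GaloisRepresentations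

end
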